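import Summits.BirchSwinnertonDyer.BirchSwinnertonDyer.Theorems.KimAtThreeDeepLowerAdditiveTorsionEndOfPinned
import Summits.BirchSwinnertonDyer.BirchSwinnertonDyer.Theorems.KimAtThreeOffStratumAdditiveDefectOfFineKato
import Summits.BirchSwinnertonDyer.BirchSwinnertonDyer.Theorems.KimAtThreeDeepUpperDefectWitnessOfZetaBody
import HarnessLib

/-!
# Route `KimAtThreeKolyvagin` (rung W2), crux 19679 (`DeepLowerAtThreeOffKatoStratum`), stub `stub_additiveDefect`:
# the `t ≥ 1` additive rows ⟸ the fine Kato package (C1₂ᵗ) + PUBLISHED facts ONLY — no S24-DEEP port, no (R₁)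
# (cell `bsd-addord`, seat `bsd-addord-w2-acc3` (PROGRAMME PART 1b row (3)), gen 4)

HONEST FRAMING. TOOL theorems only (no definition, no named fact, no `sorry`); nothing asserted, nothing booked, no
mark moved; crux 19679 stays OPEN (its OWNER assembles).  `--supports` stmt-BirchSwinnertonDyer-19679.

## What and why

This seat's `KimAtThreeOffStratumTorsionRowsOfFineKato` (p487871, same gen) made the `t ≥ 1` additive rows of 19679 THEOREMS
modulo the fine Kato package (C1₂ᵗ) — but through the S24-DEEP ports (FLAG `S24-DEEP-PORT@3`) of the deep family.
With seat w2-c2 gen 6's `exists_deepFamily_of_pinned_with` (the family from Sakamoto 2024 Thm. 4.4 (1)(2) AS PRINTED) and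
this seat's re-keyed END `KimAtThreeDeepLowerAdditiveTorsionEndOfPinned`, the same rows now rest on PUBLISHED facts + (C1₂ᵗ)
only.  This file is p487871 with `hS24d hS24d₂ ↦ hS24 hS24₂`:

* §1 `deepLower_datum_of_zetaBody_of_addv_pinned` — crux 19679's conclusion on an additive row, every `t`, every `e`, ⟸
  [S24] (1)(2) PINNED + GZK + PT + the ZetaBody package for `D.f` at torsion exponent `t` (`N₀ = 2` from additivity).
* §2 `torsionRows_of_pinned_of_fineKatoT : [S24](1)(2) → GZK → PT → (C1₂ᵗ) → (R₁)`.
* §3 **`stub19679_additiveDefect_of_fineKato_of_fineKatoT_pinned : [S24](1)(2) → GZK → PT → (C1₂) → (C1₂ᵗ) → ⟨19679 stub VERBATIM⟩`**.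

NET for the OWNER / the planner's residual of record.  The registered `stub_additiveDefect` of crux 19679 now rests on
{[S24] Thm. 4.4 (1)(2) (PUB, pinned), GZK (PUB), Poitou–Tate (PUB)} + ONE construction-shaped object, the fine Kato
package — (C1₂) on the `t = 0` defect rows, (C1₂ᵗ) on the `t ≥ 1` rows (the same object at torsion exponent `t`;
`defn-BlochKatoDualExponential` lane; = crux 19560's (C1) with rider (ii) ↦ (ii₂)).  No port, no flag, no row displaying
its own conclusion.  Composition with the skeleton's `DeepLowerAtThreeOffKatoStratum_of` is by `exact` on §3's type.
Credit: acc6 gen 0/2, w2-c3 gen 4/5/6, w2-c2 gen 0–6, w2-c4, w2-c5, kim3, acc1, team n1011; this seat re-keys.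
References: [Kato2004Asterisque] (8.1.3), §8.2, Lemma 8.5, Prop. 8.12, §9.4, Thm. 9.7, Thm. 6.6 (1), Ex. 13.3;
[Kim2022StructureSelmer] §3.1–§3.3, Thm. 3.6, Thm. 3.13; [MazurRubin2004] Thm. 3.2.4, Thm. 5.2.12, App. A (Prop. A.2,
Remark A.5); [Sakamoto2024] Thm. 4.4 (1)(2), Lemma 5.2; [Kim2025RefinedTNC] Thm 1.1/1.2, §4.2, §8.1.2; [Rubin2000]
Thm. 4.5.1; [TateGCFT1967] §2.4; [SilvermanATAEC1994] IV.9.2; cell memo kim3/KIM3-PROOF.md §14 (Theorem A-t).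
-/

set_option autoImplicit false
-- the Theorems namespace of a single-conjunct summit repeats the summit name by design (D-0017)
set_option linter.dupNamespace false

noncomputable section

open scoped NumberField TensorProduct ContRepresentation Classical
open Field Finset IsDedekindDomain NumberField WeierstrassCurve Rat.HeightOneSpectrum
open Literature.NumberTheory.GaloisRepresentations Literature.NumberTheory.GaloisCohomology
open Literature.NumberTheory.GaloisRepresentations.DiscreteGaloisModule
open Literature.NumberTheory.EllipticCurves Literature.NumberTheory.EllipticCurves.ModularForms
open Literature.NumberTheory.EllipticCurves.Rank1Residual
open Literature.NumberTheory.EllipticCurves.Kato2004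
open Literature.NumberTheory.EllipticCurves.Kato2004.EulerSystemValues
open Summit.BirchSwinnertonDyer.Rank1Residual.GaloisImage
open Summit.BirchSwinnertonDyer.BirchSwinnertonDyer.Theorems
open Summit.BirchSwinnertonDyer.BirchSwinnertonDyer.Theorems.KimAtThreeKolyvaginDefs
open Summit.BirchSwinnertonDyer.BirchSwinnertonDyer.Theorems.KimAtThreeKolyvaginPortShared
open Summit.BirchSwinnertonDyer.BirchSwinnertonDyer.Theorems.KimAtThreeDeepUpperCertSupplyDefect
open Summit.BirchSwinnertonDyer.BirchSwinnertonDyer.Theorems.KimAtThreeDeepLowerOffStratumAdditiveDefectPortTwoExp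
open Summit.BirchSwinnertonDyer.BirchSwinnertonDyer.Theorems.KimAtThreeOffStratumAdditiveDefectOfFineKato
open Summit.BirchSwinnertonDyer.BirchSwinnertonDyer.Theorems.KimAtThreeDeepLowerAdditiveTorsionEndOfPinned

namespace Summit.BirchSwinnertonDyer.BirchSwinnertonDyer.Theorems.KimAtThreeOffStratumTorsionRowsOfFineKatoPinned

/-- Local notation: the TWO-EXPONENT rider clause (ii₂) at depth `j`, torsion exponent `t`, defect exponent
`e`, place `v`, for the pair `(Λ, Λf)` (n1011's `KatoExpStarFiniteLevelAt` clause (ii), conclusion `× 3^e`). -/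
local notation3 (prettyPrint := false) "RIDER₂⟦" W' ", " j ", " t' ", " e' ", " v' ", " Λ' ", " Λf "⟧" =>
  ∀ (r : Finset (HeightOneSpectrum (𝓞 ℚ)))
    (Ψ : H1 (tateRep W' 3) (cycSubgroup 3 0 r) →+
      continuousCohomology 1
        (subgroupRep (WeierstrassCurve.torsionGaloisModule W' (((3 : ℕ) : ℤ) ^ j * ((3 : ℕ) : ℤ))).toTopRep
          (cycSubgroup 3 0 r))),
    (∀ (φ : contOneCocycles (subgroupRep (tateRep W' 3).toTopRep (cycSubgroup 3 0 r)))
        (ψ : contOneCocycles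
          (subgroupRep (WeierstrassCurve.torsionGaloisModule W' (((3 : ℕ) : ℤ) ^ j * ((3 : ℕ) : ℤ))).toTopRep
            (cycSubgroup 3 0 r))),
        (∀ g, ((ψ.1 g : geomTorsion W' (((3 : ℕ) : ℤ) ^ j * ((3 : ℕ) : ℤ))) : geomPoints W') =
          TateModule.proj 3 (j + 1) (φ.1 g)) →
        Ψ (oneCocycleClass _ φ) = oneCocycleClass _ ψ) →
    ∀ (y : H1 (tateRep W' 3) (cycSubgroup 3 0 r))
      (κ₀ : galoisCohomology (WeierstrassCurve.torsionGaloisModule W' (((3 : ℕ) : ℤ) ^ j * ((3 : ℕ) : ℤ))) 1)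
      (s : ℤ_[3]),
      resSubgroup (WeierstrassCurve.torsionGaloisModule W' (((3 : ℕ) : ℤ) ^ j * ((3 : ℕ) : ℤ))).toTopRep
          (cycSubgroup 3 0 r) 1 κ₀ = Ψ y →
      galoisCohomology.localization (WeierstrassCurve.torsionGaloisModule W' (((3 : ℕ) : ℤ) ^ j * ((3 : ℕ) : ℤ)))
          (Sum.inr v') 1 κ₀ ∈ propagatedSelmerStructure W' 3 j (Sum.inr v') →
      (∃ l ∈ cycIntLattice 3 (cycLevel 3 0 r),
          (((3 : ℕ) : ℤ_[3]) ^ t') • Λ' 0 r y - ((s : ℚ_[3]) ⊗ₜ[ℚ] (1 : CyclotomicField (cycLevel 3 0 r) ℚ)) =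
            (((3 : ℕ) : ℤ_[3]) ^ (j + 1)) • (l : ℚ_[3] ⊗[ℚ] CyclotomicField (cycLevel 3 0 r) ℚ)) →
      ((3 ^ e' : ℕ) : ZMod (3 ^ (j + 1))) *
        Λf (galoisCohomology.localization
          (WeierstrassCurve.torsionGaloisModule W' (((3 : ℕ) : ℤ) ^ j * ((3 : ℕ) : ℤ))) (Sum.inr v') 1 κ₀) =
        PadicInt.toZModPow (j + 1) s

section End

variable (W : WeierstrassCurve ℚ) [W.IsElliptic] [W.IsGloballyMinimal]
  [ContinuousSMul ℤ_[3] (W.tateModule 3)] [Module.Free ℤ_[3] (W.tateModule 3)]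
  [Module.Finite ℤ_[3] (W.tateModule 3)]

/-! ### §1 The row theorem with NO torsion hypothesis (`N₀ = 2` from additivity) -/

/-- **§1 Crux 19679's conclusion on EVERY additive row, every `t`, PORT-FREE, with NO torsion hypothesis: `N₀ = 2`
from additivity** (n1011-p13's `hstab_two_of_hasAdditiveReductionAt`: `27·P = 0 → 9·P = 0` on `E(ℚ_w)` at an additive place `w ∣ 3`, Silverman
ATAEC IV.9.2; `Addv W 3` ⟹ additive at `w` by seat acc1's `hasAdditiveReductionAt_of_addv`).  = this seat's
`KimAtThreeDeepLowerAdditiveTorsionEndOfPinned.deepLower_datum_of_zetaBody_of_stable_pinned` at `N₀ = 2`: the conclusion on every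
additive optimal tower row of analytic rank `0`, every `t`, ⟸ [S24] (1)(2) PINNED (PUB) + GZK + PT + the ZetaBody package
at torsion exponent `t` (NO S24-DEEP port: `…EndOfPinned.deepLower_datum_of_zetaBody_of_stable_pinned`).
[cite: Kim2025RefinedTNC, Thm 1.1 and §8.1.2] [cite: Sakamoto2024, Thm. 4.4 (1)(2) (p. 926)]
[cite: MazurRubin2004, App. A Prop. A.2 (pp. 79–80)] [cite: SilvermanATAEC1994, Cor. IV.9.2 (d)]
[cite: Kim2022StructureSelmer, Thm. 1.9 (6) and Thm. 3.13] -/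
theorem deepLower_datum_of_zetaBody_of_addv_pinned
    (hS24 : Sakamoto2024.kolyvaginSystems_freeRankOne_zmod_three_pow)
    (hS24₂ : Sakamoto2024.kolyvaginSystems_idealOfBasis_eq_fittingIdeal_zmod_three_pow)
    (hGZK : rank_eq_analyticRank_of_analyticRank_le_one)
    (hPT : poitouTate_selmerStructure_duality ℚ)
    (t e : ℕ)
    (hadd : haveI : Fact (Nat.Prime 3) := ⟨Nat.prime_three⟩; Addv W 3)
    (htower : ∀ m : ℕ, W.HasSurjectiveModNGaloisRep (3 ^ m : ℕ))
    (ht : Nat.card {Q : (W.baseChange ℚ_[3]).toAffine.Point // (3 : ℕ) • Q = 0} = 3 ^ t)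
    {N : ℕ} [NeZero N] (hNc : N = W.conductorNorm ℤ) (D : ModularParametrizationData W N)
    (v₃ : HeightOneSpectrum (𝓞 ℚ)) (hv₃ : ((3 : ℕ) : 𝓞 ℚ) ∈ v₃.asIdeal)
    (η : (q : HeightOneSpectrum (𝓞 ℚ)) → (ZMod (Ideal.absNorm q.asIdeal))ˣ)
    (hη : ∀ q : HeightOneSpectrum (𝓞 ℚ), Subgroup.zpowers (η q) = ⊤)
    {ι : (n : ℕ) → (CyclotomicField n ℚ →+* ℂ)} {κK : ℝ}
    {Λ : ∀ (k' : ℕ) (r : Finset (HeightOneSpectrum (𝓞 ℚ))),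
      H1 (tateRep W 3) (cycSubgroup 3 k' r) →ₗ[ℤ_[3]] ℚ_[3] ⊗[ℚ] CyclotomicField (cycLevel 3 k' r) ℚ}
    {c d a : ℤ} {A : ℕ} [NeZero A]
    {z : ∀ (k' : ℕ) (r : (cyclotomicLevelsRat 3 (badPlaces c d A N)).Ideals),
      H1 (tateRep W 3) ((cyclotomicLevelsRat 3 (badPlaces c d A N)).level k' r.1)}
    {x : ∀ (k' : ℕ) (r : (cyclotomicLevelsRat 3 (badPlaces c d A N)).Ideals),
      CyclotomicField (cycLevel 3 k' r.1) ℚ}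
    (hbody : ZetaBody W 3 D.f ι κK Λ c d a A z x)
    (Λfin : ∀ j : ℕ, galoisCohomology ((W.torsionGaloisModule (((3 : ℕ) : ℤ) ^ j * ((3 : ℕ) : ℤ))).toLocal
      (Sum.inr v₃)) 1 →+ ZMod (3 ^ (j + 1)))
    (hΛ : ∀ j : ℕ,
      (∀ c : ZMod (3 ^ (j + 1)), ∃ x ∈ propagatedSelmerStructure W 3 j (Sum.inr v₃), Λfin j x = c) ∧
      (∀ x ∈ propagatedSelmerStructure W 3 j (Sum.inr v₃),
        Λfin j x = 0 ↔ x ∈ W.kummerSelmerStructure (((3 : ℕ) : ℤ) ^ j * ((3 : ℕ) : ℤ)) (Sum.inr v₃)))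
    (hfin₂ : ∀ j : ℕ, RIDER₂⟦W, j, t, e, v₃, Λ, Λfin j⟧)
    (hcdA : ∀ q : ℕ, q.Prime → q ≡ 1 [MOD 3] → ¬ q ∣ 2 * c.natAbs * d.natAbs * A)
    (hNorm : ∃ u : ℚ, (u : ℝ) = κK ∧ padicValRat 3 u = 0) (hκ0 : κK ≠ 0)
    (d' : ℤ) (hcd : Int.gcd (c * d) A = 1) (hdd' : d * d' ≡ 1 [ZMOD (A : ℤ)])
    (hAN : Nat.Coprime A N)
    (aM : ℕ → ℤ) (haM : ∀ q ∈ (3 * A).primeFactors, cuspCoeff D.f q = aM q)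
    (hE0 : ∏ q ∈ (3 * A).primeFactors, (1 - (aM q : ℚ) / q + (if q ∣ N then 0 else (1 / q : ℚ))) ≠ 0)
    (hE : padicValRat 3
      (∏ q ∈ (3 * A).primeFactors, (1 - (aM q : ℚ) / q + (if q ∣ N then 0 else (1 / q : ℚ)))) = 0)
    (hR0 : (c : ℚ) ^ 2 * (d : ℚ) ^ 2 * ratMinusSymbol D.f ((a : ℚ) / A) -
        (c : ℚ) * (d : ℚ) ^ 2 * ratMinusSymbol D.f ((a * c : ℚ) / A) -
        (c : ℚ) ^ 2 * (d : ℚ) * ratMinusSymbol D.f ((a * d' : ℚ) / A) +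
        (c : ℚ) * (d : ℚ) * ratMinusSymbol D.f ((a * c * d' : ℚ) / A) ≠ 0)
    (hR : padicValRat 3 ((c : ℚ) ^ 2 * (d : ℚ) ^ 2 * ratMinusSymbol D.f ((a : ℚ) / A) -
        (c : ℚ) * (d : ℚ) ^ 2 * ratMinusSymbol D.f ((a * c : ℚ) / A) -
        (c : ℚ) ^ 2 * (d : ℚ) * ratMinusSymbol D.f ((a * d' : ℚ) / A) +
        (c : ℚ) * (d : ℚ) * ratMinusSymbol D.f ((a * c * d' : ℚ) / A)) = 0)
    (hord : kuriharaVanishingOrder W 3 D.f = 0) :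
    ∃ d₀ : ℕ, kuriharaPartialDeepInfty W 3 D.f = d₀ ∧
      kuriharaPartial W 3 D.f 0 ≤
        ((padicValNat 3 (Nat.card (AddCommGroup.primaryComponent W.sha 3)) + d₀ : ℕ) : ℕ∞) :=
  deepLower_datum_of_zetaBody_of_stable_pinned W hS24 hS24₂ hGZK hPT t e 2 hadd htower ht hNc D v₃ hv₃ η hη hbody Λfin
    hΛ hfin₂ hcdA
    (fun w hw => hstab_two_of_hasAdditiveReductionAt W hw
      (KimAtThreeDeepUpperDefectWitnessOfZetaBody.hasAdditiveReductionAt_of_addv W hadd w hw))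
    hNorm hκ0 d' hcd hdd' hAN aM haM hE0 hE hR0 hR hord

end End

/-! ### Local notations: (C1₂), (C1₂ᵗ), (R₁), the registered stub -/

/-- Local notation: **(C1₂) the FINE KATO PACKAGE in two-exponent form** on the additive-defect rows. -/
local notation3 (prettyPrint := false) "FINEKATO₂" =>
  ∀ (W : WeierstrassCurve ℚ) [W.IsElliptic] [W.IsGloballyMinimal]
    [ContinuousSMul ℤ_[3] (W.tateModule 3)] [Module.Free ℤ_[3] (W.tateModule 3)]
    [Module.Finite ℤ_[3] (W.tateModule 3)],
    (∀ m : ℕ, W.HasSurjectiveModNGaloisRep (3 ^ m : ℕ)) →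
    (haveI : Fact (Nat.Prime 3) := ⟨Nat.prime_three⟩; Addv W 3) →
    Nat.card {Q : (W.baseChange ℚ_[3]).toAffine.Point // (3 : ℕ) • Q = 0} = 1 →
    ∀ (v₃ : HeightOneSpectrum (𝓞 ℚ)), ((3 : ℕ) : 𝓞 ℚ) ∈ v₃.asIdeal →
    ∀ {N : ℕ} [NeZero N] (P : ModularParametrizationData W N), N = W.conductorNorm ℤ →
      (∀ z ∈ P.L.lattice, ∃ w ∈ periodLattice P.f, z = P.c * w) →
      (3 ∣ (W.baseChange ℚ_[3]).localTamagawaNumber ℤ_[3] ∨ (3 : ℤ) ∣ P.maninConstant) →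
      ∃ (ι : (n : ℕ) → (CyclotomicField n ℚ →+* ℂ)) (κK : ℝ)
        (Λ : ∀ (k' : ℕ) (r : Finset (HeightOneSpectrum (𝓞 ℚ))),
          H1 (tateRep W 3) (cycSubgroup 3 k' r) →ₗ[ℤ_[3]]
            ℚ_[3] ⊗[ℚ] CyclotomicField (cycLevel 3 k' r) ℚ)
        (Λfin : ∀ j : ℕ, galoisCohomology
          ((W.torsionGaloisModule (((3 : ℕ) : ℤ) ^ j * ((3 : ℕ) : ℤ))).toLocal (Sum.inr v₃)) 1 →+
            ZMod (3 ^ (j + 1))) (e : ℕ),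
        κK ≠ 0 ∧ (∃ u : ℚ, (u : ℝ) = κK ∧ padicValRat 3 u = 0) ∧
        (∀ j : ℕ,
          (∀ c : ZMod (3 ^ (j + 1)), ∃ x ∈ propagatedSelmerStructure W 3 j (Sum.inr v₃), Λfin j x = c) ∧
          (∀ x ∈ propagatedSelmerStructure W 3 j (Sum.inr v₃),
            Λfin j x = 0 ↔ x ∈ W.kummerSelmerStructure (((3 : ℕ) : ℤ) ^ j * ((3 : ℕ) : ℤ)) (Sum.inr v₃))) ∧
        (∀ j : ℕ, RIDER₂⟦W, j, 0, e, v₃, Λ, Λfin j⟧) ∧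
        ∀ (c d a : ℤ) (A : ℕ), 0 < A → Int.gcd c (6 * 3 * A) = 1 → Int.gcd d (6 * 3 * N) = 1 →
          ∃ (z : ∀ (k' : ℕ) (r : (cyclotomicLevelsRat 3 (badPlaces c d A N)).Ideals),
                H1 (tateRep W 3) ((cyclotomicLevelsRat 3 (badPlaces c d A N)).level k' r.1))
            (x : ∀ (k' : ℕ) (r : (cyclotomicLevelsRat 3 (badPlaces c d A N)).Ideals),
                CyclotomicField (cycLevel 3 k' r.1) ℚ),
            ZetaBody W 3 P.f ι κK Λ c d a A z x

/-- Local notation: **(C1₂ᵗ) the FINE KATO PACKAGE in two-exponent form on the additive rows with `#E(ℚ₃)[3] = 3^t`,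
`1 ≤ t`** — (C1₂) with the row binders `#E(ℚ₃)[3] = 1`, `3 ∣ c₃ ∨ 3 ∣ c_P` replaced by `1 ≤ t`, `#E(ℚ₃)[3] = 3^t`, and
the rider clause (ii₂) read at torsion exponent `t` (the SAME object: SOME Kato witnesses of the `ZetaBody` family with
finite-level functionals, (Λ)-clauses and two-exponent riders for ONE `e`; CONSTRUCTION-SHAPED, never `_holds`). -/
local notation3 (prettyPrint := false) "FINEKATOᵀ" =>
  ∀ (W : WeierstrassCurve ℚ) [W.IsElliptic] [W.IsGloballyMinimal]
    [ContinuousSMul ℤ_[3] (W.tateModule 3)] [Module.Free ℤ_[3] (W.tateModule 3)]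
    [Module.Finite ℤ_[3] (W.tateModule 3)],
    (∀ m : ℕ, W.HasSurjectiveModNGaloisRep (3 ^ m : ℕ)) →
    (haveI : Fact (Nat.Prime 3) := ⟨Nat.prime_three⟩; Addv W 3) →
    ∀ (t : ℕ), 1 ≤ t → Nat.card {Q : (W.baseChange ℚ_[3]).toAffine.Point // (3 : ℕ) • Q = 0} = 3 ^ t →
    ∀ (v₃ : HeightOneSpectrum (𝓞 ℚ)), ((3 : ℕ) : 𝓞 ℚ) ∈ v₃.asIdeal →
    ∀ {N : ℕ} [NeZero N] (P : ModularParametrizationData W N), N = W.conductorNorm ℤ →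
      (∀ z ∈ P.L.lattice, ∃ w ∈ periodLattice P.f, z = P.c * w) →
      ∃ (ι : (n : ℕ) → (CyclotomicField n ℚ →+* ℂ)) (κK : ℝ)
        (Λ : ∀ (k' : ℕ) (r : Finset (HeightOneSpectrum (𝓞 ℚ))),
          H1 (tateRep W 3) (cycSubgroup 3 k' r) →ₗ[ℤ_[3]]
            ℚ_[3] ⊗[ℚ] CyclotomicField (cycLevel 3 k' r) ℚ)
        (Λfin : ∀ j : ℕ, galoisCohomology
          ((W.torsionGaloisModule (((3 : ℕ) : ℤ) ^ j * ((3 : ℕ) : ℤ))).toLocal (Sum.inr v₃)) 1 →+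
            ZMod (3 ^ (j + 1))) (e : ℕ),
        κK ≠ 0 ∧ (∃ u : ℚ, (u : ℝ) = κK ∧ padicValRat 3 u = 0) ∧
        (∀ j : ℕ,
          (∀ c : ZMod (3 ^ (j + 1)), ∃ x ∈ propagatedSelmerStructure W 3 j (Sum.inr v₃), Λfin j x = c) ∧
          (∀ x ∈ propagatedSelmerStructure W 3 j (Sum.inr v₃),
            Λfin j x = 0 ↔ x ∈ W.kummerSelmerStructure (((3 : ℕ) : ℤ) ^ j * ((3 : ℕ) : ℤ)) (Sum.inr v₃))) ∧
        (∀ j : ℕ, RIDER₂⟦W, j, t, e, v₃, Λ, Λfin j⟧) ∧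
        ∀ (c d a : ℤ) (A : ℕ), 0 < A → Int.gcd c (6 * 3 * A) = 1 → Int.gcd d (6 * 3 * N) = 1 →
          ∃ (z : ∀ (k' : ℕ) (r : (cyclotomicLevelsRat 3 (badPlaces c d A N)).Ideals),
                H1 (tateRep W 3) ((cyclotomicLevelsRat 3 (badPlaces c d A N)).level k' r.1))
            (x : ∀ (k' : ℕ) (r : (cyclotomicLevelsRat 3 (badPlaces c d A N)).Ideals),
                CyclotomicField (cycLevel 3 k' r.1) ℚ),
            ZetaBody W 3 P.f ι κK Λ c d a A z x

/-- Local notation: **(R₁) the `t ≥ 1` additive rows** — the conclusion of crux 19679 DISPLAYED on the additive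
optimal tower rows of analytic rank `0` with `#E(ℚ₃)[3] ≠ 1` (binders of the registered stub verbatim, the defect
disjunction replaced by its torsion disjunct; this seat's TorsionSplit §8 `hTors`). -/
local notation3 (prettyPrint := false) "TORSROWS" =>
  ∀ (W₀ : WeierstrassCurve ℚ) [W₀.IsElliptic] [W₀.IsGloballyMinimal],
    (∀ n : ℕ, W₀.HasSurjectiveModNGaloisRep (3 ^ n : ℕ)) → Finite W₀.sha →
    ∀ {N : ℕ} [NeZero N], N = W₀.conductorNorm ℤ →
    ∀ (D₀ : ModularParametrizationData W₀ N),
      (∀ z ∈ D₀.L.lattice, ∃ w ∈ periodLattice D₀.f, z = D₀.c * w) →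
      (∀ (W₂ : WeierstrassCurve ℚ) [W₂.IsElliptic] (D₂ : ModularParametrizationData W₂ N),
        D₂.f = D₀.f → D₀.modularDegree ≤ D₂.modularDegree) →
      (∀ r : ℚ, ratPlusSymbol D₀.f r ≠ 0 → 0 ≤ padicValRat 3 (ratPlusSymbol D₀.f r)) →
      kuriharaVanishingOrder W₀ 3 D₀.f = 0 →
      (haveI : Fact (Nat.Prime 3) := ⟨Nat.prime_three⟩; Addv W₀ 3) →
      Nat.card {Q : (W₀.baseChange ℚ_[3]).toAffine.Point // (3 : ℕ) • Q = 0} ≠ 1 →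
      ∃ d : ℕ, kuriharaPartialDeepInfty W₀ 3 D₀.f = d ∧
        kuriharaPartial W₀ 3 D₀.f 0 ≤
          ((padicValNat 3 (Nat.card (AddCommGroup.primaryComponent W₀.sha 3)) + d : ℕ) : ℕ∞)

/-- Local notation: the registered `stub_additiveDefect` signature of crux 19679 (BC3 birth skeleton e575d030),
VERBATIM. -/
local notation3 (prettyPrint := false) "STUB19679" =>
  ∀ (W₀ : WeierstrassCurve ℚ) [W₀.IsElliptic] [W₀.IsGloballyMinimal],
    (∀ n : ℕ, W₀.HasSurjectiveModNGaloisRep (3 ^ n : ℕ)) → Finite W₀.sha →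
    ∀ {N : ℕ} [NeZero N], N = W₀.conductorNorm ℤ →
    ∀ (D₀ : Literature.NumberTheory.EllipticCurves.ModularForms.ModularParametrizationData W₀ N),
      (∀ z ∈ D₀.L.lattice, ∃ w ∈ Literature.NumberTheory.EllipticCurves.ModularForms.periodLattice D₀.f, z = D₀.c * w) →
      (∀ (W₂ : WeierstrassCurve ℚ) [W₂.IsElliptic]
        (D₂ : Literature.NumberTheory.EllipticCurves.ModularForms.ModularParametrizationData W₂ N),
        D₂.f = D₀.f → D₀.modularDegree ≤ D₂.modularDegree) →
      (∀ r : ℚ, Literature.NumberTheory.EllipticCurves.ratPlusSymbol D₀.f r ≠ 0 →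
        0 ≤ padicValRat 3 (Literature.NumberTheory.EllipticCurves.ratPlusSymbol D₀.f r)) →
      Literature.NumberTheory.EllipticCurves.kuriharaVanishingOrder W₀ 3 D₀.f = 0 →
      (haveI : Fact (Nat.Prime 3) := ⟨Nat.prime_three⟩;
          Literature.NumberTheory.EllipticCurves.Rank1Residual.Addv W₀ 3) →
      (3 ∣ (W₀.baseChange ℚ_[3]).localTamagawaNumber ℤ_[3] ∨
        Nat.card {Q : (W₀.baseChange ℚ_[3]).toAffine.Point // (3 : ℕ) • Q = 0} ≠ 1 ∨
        (3 : ℤ) ∣ D₀.maninConstant) →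
      ∃ d : ℕ, Literature.NumberTheory.EllipticCurves.kuriharaPartialDeepInfty W₀ 3 D₀.f = d ∧
        Literature.NumberTheory.EllipticCurves.kuriharaPartial W₀ 3 D₀.f 0 ≤
          ((padicValNat 3 (Nat.card (AddCommGroup.primaryComponent W₀.sha 3)) + d : ℕ) : ℕ∞)

/-! ### §2 (R₁) ⟸ [S24] PINNED + GZK + PT + (C1₂ᵗ): the `t ≥ 1` additive rows are theorems modulo the fine Kato package -/

/-- **The `t ≥ 1` line (R₁) of this seat's gen 3 ⟸ [S24] Thm. 4.4 (1)(2) PINNED (PUB) + GZK + Poitou–Tate BY NAME + the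
fine Kato package (C1₂ᵗ) on the `t ≥ 1` additive rows — on EVERY such row, NO S24-DEEP port.**  On a `t ≥ 1` additive
optimal tower row of analytic rank `0`: `#E(ℚ₃)[3] = 3^t` for some `t ≥ 1` (`exists_natCard_threeTorsion_eq_three_pow`),
Kato's auxiliary cusp datum with unit value certificates exists (seat w2-c3's THEOREM `certSupply_of_addv`: surj(3) +
`Addv`), (C1₂ᵗ) supplies the witnesses for `D₀.f`, and §1 (`N₀ = 2` from additivity) concludes at a constructed place
`v₃ ∣ 3` and generator family `η`.  Nothing asserted. [cite: Kim2025RefinedTNC, Thm 1.1 and §8.1.2]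
[cite: Kim2022StructureSelmer, Thm. 1.9 (6), Thm. 3.13] [cite: Sakamoto2024, Thm. 4.4 (p. 926)]
[cite: MazurRubin2004, Thm. 5.2.12, Cor. 5.2.13 and App. A Prop. A.2] [cite: Kato2004Asterisque, §9.4, Thm. 9.7, Ex. 13.3]
[cite: TateGCFT1967, §2.4] -/
theorem torsionRows_of_pinned_of_fineKatoT
    (hS24 : Sakamoto2024.kolyvaginSystems_freeRankOne_zmod_three_pow)
    (hS24₂ : Sakamoto2024.kolyvaginSystems_idealOfBasis_eq_fittingIdeal_zmod_three_pow)
    (hGZK : rank_eq_analyticRank_of_analyticRank_le_one)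
    (hPT : poitouTate_selmerStructure_duality ℚ)
    (hC1 : FINEKATOᵀ) : TORSROWS := by
  intro W₀ _ _ htow _ N _ hN D₀ hopt _ _ hord hA ht1
  haveI : Fact (Nat.Prime 3) := ⟨Nat.prime_three⟩
  haveI : ContinuousSMul ℤ_[3] (W₀.tateModule 3) := TateModule.continuousSMul_padicInt
  haveI : Module.Free ℤ_[3] (W₀.tateModule 3) := W₀.module_free_tateModule_holds 3
  haveI : Module.Finite ℤ_[3] (W₀.tateModule 3) := W₀.module_finite_tateModule_holds 3
  obtain ⟨t, ht⟩ := exists_natCard_threeTorsion_eq_three_pow W₀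
  have ht0 : 1 ≤ t := by
    rcases Nat.eq_zero_or_pos t with h | h
    · exfalso
      apply ht1
      rw [ht, h, pow_zero]
    · exact h
  obtain ⟨v₃, η, hv₃, hη⟩ := KimAtThreeShallowEqDeepSplitGlueNoStub.exists_place_three_and_generators
  obtain ⟨c, d, a, A, d', aM, hA0, hcA, hdN, hcdA, hcd, hdd', hAN, haM, hE0, hE, hR0, hR⟩ :=
    certSupply_of_addv W₀ (by simpa using htow 1) hA D₀ hN
  haveI : NeZero A := ⟨hA0.ne'⟩
  obtain ⟨ι, κK, Λ, Λfin, e, hκ0, hNorm, hΛ, hfin₂, hz⟩ := hC1 W₀ htow hA t ht0 ht v₃ hv₃ D₀ hN hopt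
  obtain ⟨z, x, hbody⟩ := hz c d a A hA0 hcA hdN
  exact deepLower_datum_of_zetaBody_of_addv_pinned W₀ hS24 hS24₂ hGZK hPT t e hA htow ht hN D₀ v₃ hv₃ η hη hbody Λfin
    hΛ hfin₂ hcdA hNorm hκ0 d' hcd hdd' hAN aM haM hE0 hE hR0 hR hord

/-! ### §3 The registered stub of crux 19679 from PUBLISHED facts + (C1₂) + (C1₂ᵗ) — nothing else -/

/-- **`stub_additiveDefect` of crux 19679 (`DeepLowerAtThreeOffKatoStratum`), TYPE VERBATIM, ⟸ [S24] Thm. 4.4 (1)(2)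
(PUB, pinned), GZK (PUB), Poitou–Tate (PUB) + the fine Kato package (C1₂) on the `t = 0` defect rows + the fine Kato
package (C1₂ᵗ) on the `t ≥ 1` additive rows (both displayed, construction-shaped, ONE object)** — this seat's gen-3
`stub19679_additiveDefect_of_fineKato_of_torsionRows` fed by §2.  Versus gen 3 / p487871: no (R₁), no S24-DEEP port; the
stub's ENTIRE non-published input is the fine Kato package.  Composition with the skeleton's `DeepLowerAtThreeOffKatoStratum_of` is by `exact` on this type.
Crux 19679 stays OPEN. [cite: Kim2025RefinedTNC, Thm 1.1 and §8.1.2] [cite: Kim2022StructureSelmer, Thm. 1.9 (6), Thm. 3.13]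
[cite: Sakamoto2024, Thm. 4.4 (1)(2) (p. 926)] [cite: MazurRubin2004, Thm. 5.2.12 and App. A Prop. A.2]
[cite: Kato2004Asterisque, §9.4 and Thm. 9.7 (pp. 188–189)] -/
theorem stub19679_additiveDefect_of_fineKato_of_fineKatoT_pinned
    (hS24 : Sakamoto2024.kolyvaginSystems_freeRankOne_zmod_three_pow)
    (hS24₂ : Sakamoto2024.kolyvaginSystems_idealOfBasis_eq_fittingIdeal_zmod_three_pow)
    (hGZK : rank_eq_analyticRank_of_analyticRank_le_one)
    (hPT : poitouTate_selmerStructure_duality ℚ)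
    (hC1 : FINEKATO₂) (hC1t : FINEKATOᵀ) : STUB19679 :=
  stub19679_additiveDefect_of_fineKato_of_torsionRows hS24 hS24₂ hGZK hPT hC1
    (torsionRows_of_pinned_of_fineKatoT hS24 hS24₂ hGZK hPT hC1t)

end Summit.BirchSwinnertonDyer.BirchSwinnertonDyer.Theorems.KimAtThreeOffStratumTorsionRowsOfFineKatoPinned

end
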